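import Mathlib
import HarnessLib
import Summits.NavierStokesRegularity.NavierStokesRegularity.Theorems.TaylorModelRungThreeCertificateReadoutVInterp
import Summits.NavierStokesRegularity.NavierStokesRegularity.Theorems.TaylorModelRungThreeCertificateReadoutVStepSound
import Summits.NavierStokesRegularity.NavierStokesRegularity.Theorems.TaylorModelRungThreeCertificateFormatVCoreSound
import Summits.NavierStokesRegularity.NavierStokesRegularity.Theorems.TaylorModelRungThreeCertificateFormatVEntry
import Summits.NavierStokesRegularity.NavierStokesRegularity.Theorems.TaylorModelRungThreeCertificateReadoutsEnclosure

/-!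
# Crux K1b-DR (stmt-NavierStokesRegularity-23954), line `taylor-model` — v3 read-outs SOUNDNESS, part A: bridges from the
# interpreted records to the read-out kernel's hypotheses, and the clauses (R4), (R5), (R7), (R8) of `ReadoutsV`
# for the records `toCertDataVW / toBoxesW / toRadiiW / toReadoutData` (typer g32; clause text = ns-tm-g4 g3's
# `…VReadoutsDefs` p625517; record projections and weight enclosures = engine-1 g67's `…FormatVRadiiSound`/`…FormatVCoreSound`)

From `checkReadoutStage j = true` (the (R4) tests of all sub-steps and the read-out step `readoutStep (roIn j)`), the kit
hypotheses `KitOK`, and the surrogate certificate `checkReadoutAux A = true`: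
* bridges: `cd_*` field reductions of the read-out scalars (`rfl`), `vecF_loOf_eq/vecF_hiOf_eq` (hull boxes as `loR/hiR` of
  `hullBox`), `memVec_of_inBox_loR` / `inBox_loR_of_memVec`, `memVec_of_inBox_hull`, `inStep_window` (`InStepKer` in the
  kernel's window form), `idx_mod_m`, `mem_MB`, `mem_AB`;
* `readout_R4`, `readout_R5`, `readout_R7`, `readout_R8` — the clauses literally as they appear in `ReadoutsV` ((R6), (R9)–(R11) and the
  assembly `readoutsV_of_checks`: part B).

HONEST FRAMING: kernel bookkeeping for the MODEL certificate №23954 (rung TL-M3); nothing here is a statement about the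
Navier–Stokes equations.
-/

-- the sub-problem namespace repeats the summit name by design (D-0017)
set_option linter.dupNamespace false

namespace Summit.NavierStokesRegularity.NavierStokesRegularity.Theorems.TaylorModelCert

open scoped BigOperators
open Set
open Literature.Analysis.FluidPDE.TaoCascade Literature.Analysis.FluidPDE.TaoCascade.TaylorChain
open Summit.NavierStokesRegularity.NavierStokesRegularity.Theorems.TaylorModelReadout
open Summit.NavierStokesRegularity.NavierStokesRegularity.Theorems.TaylorModelV

namespace CertTablesV

variable {TV : CertTablesV} {kitOf : ℕ → CoreKit} {wT : ℕ → Array Dyad} {sc : ScalarsV} {A : ReadoutAux QS2}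

/-! ### Field reductions of the read-out scalars (all definitional) -/

section Rfl

/-- [folklore] -/
theorem cd_sigma (j : ℕ) : (TV.toCertDataVW kitOf wT sc).σf j = TV.base.covR QS2.toRealHom (TV.base.stage j).σf := rfl
/-- [folklore] -/ theorem cd_gamma (j : ℕ) : (TV.toCertDataVW kitOf wT sc).γ j = QS2.toRealHom (TV.base.stage j).γ := rfl
/-- [folklore] -/ theorem cd_lev (j : ℕ) : (TV.toCertDataVW kitOf wT sc).lev j = QS2.toRealHom (TV.base.stage j).lev := rfl
/-- [folklore] -/ theorem cd_as (j : ℕ) : (TV.toCertDataVW kitOf wT sc).as j = QS2.toRealHom (TV.base.stage j).as := rfl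
/-- [folklore] -/ theorem cd_Lam (j : ℕ) : (TV.toCertDataVW kitOf wT sc).Λ j = QS2.toRealHom (TV.base.stage j).Λ := rfl
/-- [folklore] -/ theorem cd_delta (j : ℕ) : (TV.toCertDataVW kitOf wT sc).δ j = QS2.toRealHom (TV.base.stage j).δ := rfl
/-- [folklore] -/ theorem cd_tau : (TV.toCertDataVW kitOf wT sc).τs = QS2.toRealHom TV.base.τs := rfl
/-- [folklore] -/ theorem cd_mm : (TV.toCertDataVW kitOf wT sc).mm = QS2.toRealHom TV.base.mm := rfl
/-- [folklore] -/ theorem cd_theta : (TV.toCertDataVW kitOf wT sc).θ = QS2.toRealHom TV.base.θ := rfl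
/-- [folklore] -/ theorem cd_Cb : (TV.toCertDataVW kitOf wT sc).Cb = QS2.toRealHom TV.base.Cb := rfl
/-- [folklore] -/ theorem cd_Cg : (TV.toCertDataVW kitOf wT sc).Cg = QS2.toRealHom TV.base.Cg := rfl
/-- [folklore] -/ theorem cd_i0 : (TV.toCertDataVW kitOf wT sc).i₀ = TV.base.i₀ := rfl
/-- [folklore] -/ theorem cd_nx (j : ℕ) : (TV.toCertDataVW kitOf wT sc).nx j = (TV.base.stage j).nx := rfl
/-- [folklore] -/ theorem cd_Sj (j : ℕ) : (TV.toCertDataVW kitOf wT sc).S j = (TV.base.stage j).S := rfl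
/-- [folklore] -/
theorem cd_ell (J l : ℕ) : (TV.toCertDataVW kitOf wT sc).ℓ J l = TV.base.covR QS2.toRealHom ((TV.base.stage J).ell.getD l []) := rfl
/-- [folklore] -/ theorem cd_ctr (J l : ℕ) : (TV.toCertDataVW kitOf wT sc).ctr J l = QS2.toRealHom (vget (TV.base.stage J).ctr l) := rfl
/-- [folklore] -/ theorem cd_rad (J l : ℕ) : (TV.toCertDataVW kitOf wT sc).rad J l = QS2.toRealHom (vget (TV.base.stage J).rad l) := rfl
/-- [folklore] -/ theorem cd_sl (J l : ℕ) : (TV.toCertDataVW kitOf wT sc).s J l = QS2.toRealHom (vget (TV.base.stage J).s l) := rfl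
/-- [folklore] -/ theorem cd_beta (j l : ℕ) : (TV.toCertDataVW kitOf wT sc).β j l = QS2.toRealHom (vget (TV.base.stage j).β l) := rfl
/-- [folklore] -/ theorem cd_Lv (J : ℕ) : (TV.toCertDataVW kitOf wT sc).Lv J = QS2.toRealHom (TV.base.stage J).Lv := rfl
/-- [folklore] -/
theorem cd_M (k : ℤ) : (TV.toCertDataVW kitOf wT sc).M k =
    if -TV.base.Kb - 1 ≤ k ∧ k ≤ TV.base.Ka + 1 then QS2.toRealHom (vget TV.base.M (k + TV.base.Kb + 1).toNat) else 0 := rfl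
/-- [folklore] -/ theorem cd_Qb : (TV.toCertDataVW kitOf wT sc).Qb = (TV.base.toCertData QS2.toRealHom).Qb := rfl
/-- [folklore] -/
theorem cd_land (j : ℕ) : (TV.toCertDataVW kitOf wT sc).land j = TV.base.landF (QS2.toRealHom (TV.base.stage (TV.base.stage j).nx).Lv) := rfl
/-- [folklore] -/
theorem cd_landD (j : ℕ) : (TV.toCertDataVW kitOf wT sc).landD j = TV.base.landDF (QS2.toRealHom (TV.base.stage (TV.base.stage j).nx).Lv) := rfl
/-- [folklore] -/
theorem cd_secCorr (j : ℕ) (y z : Fin 4 → ℤ → ℝ) : secCorr (TV.toCertDataVW kitOf wT sc) j y z =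
    TV.base.secCorrF QS2.toRealHom (TV.base.stage j).σf ((TV.base.toCertData QS2.toRealHom).Qb y y) z := rfl
/-- [folklore] -/ theorem bx_lo (j s : ℕ) : (TV.toBoxesW kitOf wT).lo j s = TV.base.vecF (vre (TV.coreVW kitOf wT j s).lo) := rfl
/-- [folklore] -/ theorem bx_hi (j s : ℕ) : (TV.toBoxesW kitOf wT).hi j s = TV.base.vecF (vre (TV.coreVW kitOf wT j s).hi) := rfl
/-- [folklore] -/ theorem bx_loK (j s : ℕ) : (TV.toBoxesW kitOf wT).loK j s = TV.base.vecF (vre (TV.coreVW kitOf wT j s).loK) := rfl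
/-- [folklore] -/ theorem bx_hiK (j s : ℕ) : (TV.toBoxesW kitOf wT).hiK j s = TV.base.vecF (vre (TV.coreVW kitOf wT j s).hiK) := rfl
/-- [folklore] -/ theorem bx_JU (j s : ℕ) : (TV.toBoxesW kitOf wT).JU j s = TV.base.vecF (vre (TV.coreVW kitOf wT j s).JU) := rfl
/-- [folklore] -/ theorem bx_pdegV : (TV.toBoxesW kitOf wT).pdegV = TV.pdegV := rfl
/-- [folklore] -/
theorem ro_ylo0 (G : ℕ → ℕ → ℕ → ℝ) (ΛT : ℕ → ℝ) (j : ℕ) :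
    (TV.toReadoutData kitOf wT A G ΛT).ylo 0 j = TV.base.vecF (IntervalD.loR ((TV.roIn kitOf wT A j).Y0 TV.base)) := rfl
/-- [folklore] -/
theorem ro_yhi0 (G : ℕ → ℕ → ℕ → ℝ) (ΛT : ℕ → ℝ) (j : ℕ) :
    (TV.toReadoutData kitOf wT A G ΛT).yhi 0 j = TV.base.vecF (IntervalD.hiR ((TV.roIn kitOf wT A j).Y0 TV.base)) := rfl
/-- [folklore] -/
theorem ro_ylo1 (G : ℕ → ℕ → ℕ → ℝ) (ΛT : ℕ → ℝ) (j : ℕ) :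
    (TV.toReadoutData kitOf wT A G ΛT).ylo 1 j = TV.base.vecF (IntervalD.loR ((TV.roIn kitOf wT A j).Y1 TV.base)) := rfl
/-- [folklore] -/
theorem ro_yhi1 (G : ℕ → ℕ → ℕ → ℝ) (ΛT : ℕ → ℝ) (j : ℕ) :
    (TV.toReadoutData kitOf wT A G ΛT).yhi 1 j = TV.base.vecF (IntervalD.hiR ((TV.roIn kitOf wT A j).Y1 TV.base)) := rfl
/-- [folklore] -/
theorem ro_Vlo (G : ℕ → ℕ → ℕ → ℝ) (ΛT : ℕ → ℝ) (j : ℕ) :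
    (TV.toReadoutData kitOf wT A G ΛT).Vlo j = TV.base.kerLo ((TV.roIn kitOf wT A j).VB TV.base) := rfl
/-- [folklore] -/
theorem ro_Vhi (G : ℕ → ℕ → ℕ → ℝ) (ΛT : ℕ → ℝ) (j : ℕ) :
    (TV.toReadoutData kitOf wT A G ΛT).Vhi j = TV.base.kerHi ((TV.roIn kitOf wT A j).VB TV.base) := rfl
/-- [folklore] -/
theorem roOut_ok (j : ℕ) : (TV.roOut kitOf wT A j).ok = (TV.base.readoutStep (TV.roIn kitOf wT A j)).ok := rfl

end Rfl

/-! ### Boxes: `InBox` of the records versus `MemVec` of the kernel -/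

section Boxes

/-- A `vecF (loOf x r)` end is the `vecF` of the lower ends of `boxAround`. [folklore] -/
theorem vecF_loOf_eq (x r : Array Dyad) :
    TV.base.vecF (loOf x r) = TV.base.vecF (IntervalD.loR (boxAround TV.base.n x r)) := by
  funext i k
  rw [TV.base.vecF_apply, TV.base.vecF_apply]
  split_ifs with hk
  · unfold IntervalD.loR boxAround loOf vre
    rw [IntervalD.aget_ofFn _ (TV.base.idx_lt_n i hk), Dyad.toReal_sub]
  · rfl

/-- See `vecF_loOf_eq`. [folklore] -/
theorem vecF_hiOf_eq (x r : Array Dyad) :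
    TV.base.vecF (hiOf x r) = TV.base.vecF (IntervalD.hiR (boxAround TV.base.n x r)) := by
  funext i k
  rw [TV.base.vecF_apply, TV.base.vecF_apply]
  split_ifs with hk
  · unfold IntervalD.hiR boxAround hiOf vre
    rw [IntervalD.aget_ofFn _ (TV.base.idx_lt_n i hk), Dyad.toReal_add]
  · rfl

/-- The hull boxes of `toBoxesW` are the `vecF` ends of `hullBox`. [folklore] -/
theorem bx_hlo_hullBox (l : Fin 3) (j s : ℕ) :
    (TV.toBoxesW kitOf wT).hlo l j s = TV.base.vecF (IntervalD.loR (TV.hullBox kitOf wT j l s)) := by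
  rw [bx_hlo]; exact vecF_loOf_eq _ _

/-- See `bx_hlo_hullBox`. [folklore] -/
theorem bx_hhi_hullBox (l : Fin 3) (j s : ℕ) :
    (TV.toBoxesW kitOf wT).hhi l j s = TV.base.vecF (IntervalD.hiR (TV.hullBox kitOf wT j l s)) := by
  rw [bx_hhi]; exact vecF_hiOf_eq _ _

/-- [folklore] -/
theorem size_hullBox (l : Fin 3) (j s : ℕ) : (TV.hullBox kitOf wT j l s).size = TV.base.n := by
  unfold hullBox boxAround; rw [Array.size_ofFn]

/-- `InBox` in a `loR/hiR` box of the record ⇒ `MemVec` of the window values. [folklore] -/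
theorem memVec_of_inBox_loR {Y : Array IntervalD} {y : Fin 4 → ℤ → ℝ}
    (h : InBox (TV.toCertDataVW kitOf wT sc) (TV.base.vecF (IntervalD.loR Y)) (TV.base.vecF (IntervalD.hiR Y)) y) :
    MemVec TV.base.n (TV.base.wv y) Y :=
  (TV.base.inBox_vecF_iff cd_Kb cd_Ka _ _ y).1 h

/-- Converse of `memVec_of_inBox_loR`. [folklore] -/
theorem inBox_loR_of_memVec {Y : Array IntervalD} {y : Fin 4 → ℤ → ℝ} (h : MemVec TV.base.n (TV.base.wv y) Y) :
    InBox (TV.toCertDataVW kitOf wT sc) (TV.base.vecF (IntervalD.loR Y)) (TV.base.vecF (IntervalD.hiR Y)) y :=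
  (TV.base.inBox_vecF_iff cd_Kb cd_Ka _ _ y).2 h

/-- `InBox` in a hull box of the record ⇒ `MemVec` in `hullBox`. [folklore] -/
theorem memVec_of_inBox_hull {l : Fin 3} {j s : ℕ} {y : Fin 4 → ℤ → ℝ}
    (h : InBox (TV.toCertDataVW kitOf wT sc) ((TV.toBoxesW kitOf wT).hlo l j s) ((TV.toBoxesW kitOf wT).hhi l j s) y) :
    MemVec TV.base.n (TV.base.wv y) (TV.hullBox kitOf wT j l s) := by
  rw [bx_hlo_hullBox, bx_hhi_hullBox] at h
  exact memVec_of_inBox_loR h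

/-- `InBox` ⇒ the kernel's `InBoxW` over `loR/hiR` of the outer hull box. [folklore] -/
theorem inBoxW_hull_of_inBox {l : Fin 3} {j s : ℕ} {y : Fin 4 → ℤ → ℝ}
    (h : InBox (TV.toCertDataVW kitOf wT sc) ((TV.toBoxesW kitOf wT).hlo l j s) ((TV.toBoxesW kitOf wT).hhi l j s) y) :
    TV.base.InBoxW (TV.base.vecF (IntervalD.loR (TV.hullBox kitOf wT j l s))) (TV.base.vecF (IntervalD.hiR (TV.hullBox kitOf wT j l s))) y := by
  rw [bx_hlo_hullBox, bx_hhi_hullBox] at h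
  exact (TV.base.inBoxW_iff cd_Kb cd_Ka _ _ y).1 h

end Boxes

/-! ### The in-step kernel hypothesis in window form -/

/-- `InStepKer` of the records, restated in the read-out kernel's window form. [folklore] -/
theorem inStep_window {j s : ℕ} {u : ℝ} {Ak : Ker} (hA : InStepKer (TV.toCertDataVW kitOf wT sc) (TV.toBoxesW kitOf wT) j s u Ak) :
    ∀ i' k', -TV.base.Kb ≤ k' → k' ≤ TV.base.Ka → ∀ i k, -TV.base.Kb ≤ k → k ≤ TV.base.Ka →
      ∃ ζ : Fin 4 → ℤ → ℝ, TV.base.InBoxW (TV.base.vecF (IntervalD.loR (TV.hullBox kitOf wT j 2 s)))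
          (TV.base.vecF (IntervalD.hiR (TV.hullBox kitOf wT j 2 s))) ζ ∧
        |Ak i' k' i k - ∑ n ∈ Finset.range (TV.pdegV + 1),
            varJet (TV.base.toCertData QS2.toRealHom).Qb ζ (basisSt i k) n i' k' * u ^ n|
          ≤ TV.base.vecF (vre (TV.coreVW kitOf wT j s).JU) i' k' * ((TV.toCertDataVW kitOf wT sc).ω j k)⁻¹ * u ^ (TV.pdegV + 1) := by
  intro i' k' hk1' hk2' i k hk1 hk2
  obtain ⟨ζ, hζ, hb⟩ := hA i' k' hk1' hk2' i k hk1 hk2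
  exact ⟨ζ, inBoxW_hull_of_inBox hζ, hb⟩

/-! ### (R4) -/

/-- `(idx i k) % m = (k + Kb).toNat`. [folklore] -/
theorem idx_mod_m (i : Fin 4) {k : ℤ} (hk : -TV.base.Kb ≤ k ∧ k ≤ TV.base.Ka) : TV.base.idx i k % TV.base.m = (k + TV.base.Kb).toNat := by
  have h := TV.base.wk_idx i hk
  unfold CertTables.wk at h
  omega

/-- `cd.M k ∈ MB[idx i k]` on the window. [folklore] -/
theorem mem_MB (i : Fin 4) {k : ℤ} (hk : -TV.base.Kb ≤ k ∧ k ≤ TV.base.Ka) :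
    IntervalD.mem ((TV.toCertDataVW kitOf wT sc).M k) (IntervalD.aget TV.MB (TV.base.idx i k)) := by
  rw [cd_M, if_pos ⟨by linarith [hk.1], by linarith [hk.2]⟩]
  unfold MB
  rw [IntervalD.aget_ofFn _ (TV.base.idx_lt_n i hk), idx_mod_m i hk]
  have e : (k + TV.base.Kb).toNat + 1 = (k + TV.base.Kb + 1).toNat := by omega
  rw [e]
  exact IntervalD.mem_ofQS2 _ _

/-- The allowance `Λδτs·ω_k + mm ∈ AB[idx i k]` on the window. [folklore] -/
theorem mem_AB (j : ℕ) (i : Fin 4) {k : ℤ} (hk : -TV.base.Kb ≤ k ∧ k ≤ TV.base.Ka) :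
    IntervalD.mem ((TV.toCertDataVW kitOf wT sc).Λ j * (TV.toCertDataVW kitOf wT sc).δ j * (TV.toCertDataVW kitOf wT sc).τs *
        (TV.toCertDataVW kitOf wT sc).ω j k + (TV.toCertDataVW kitOf wT sc).mm) (IntervalD.aget (TV.AB j) (TV.base.idx i k)) := by
  rw [cd_Lam, cd_delta, cd_tau, cd_mm, cd_omega j i hk]
  unfold AB
  rw [IntervalD.aget_ofFn _ (TV.base.idx_lt_n i hk)]
  have e : QS2.toRealHom (TV.base.stage j).Λ * QS2.toRealHom (TV.base.stage j).δ * QS2.toRealHom TV.base.τs *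
      QS2.toRealHom (TV.base.wgt j (TV.base.idx i k)) + QS2.toRealHom TV.base.mm =
      QS2.toRealHom ((TV.base.stage j).Λ * (TV.base.stage j).δ * TV.base.τs * TV.base.wgt j (TV.base.idx i k) + TV.base.mm) := by
    simp only [map_add, map_mul]
  rw [e]
  exact IntervalD.mem_ofQS2 _ _

/-- **(R4)** of `ReadoutsV` at stage `j` from the (R4) tests of its sub-steps. [folklore] -/
theorem readout_R4 {j : ℕ} (h4 : allN (TV.base.stage j).S (fun s => TV.base.testR4 TV.MB (TV.AB j) (TV.coreVW kitOf wT j s)) = true) :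
    ∀ s', s' < (TV.toCertDataVW kitOf wT sc).S j → ∀ i k, -(TV.toCertDataVW kitOf wT sc).Kb ≤ k → k ≤ (TV.toCertDataVW kitOf wT sc).Ka →
      -(TV.toCertDataVW kitOf wT sc).M k ≤ (TV.toBoxesW kitOf wT).lo j s' i k + (TV.toBoxesW kitOf wT).loK j s' i k ∧
      (TV.toBoxesW kitOf wT).hi j s' i k + (TV.toBoxesW kitOf wT).hiK j s' i k ≤ (TV.toCertDataVW kitOf wT sc).M k ∧
      -((TV.toCertDataVW kitOf wT sc).M k - (TV.toCertDataVW kitOf wT sc).Λ j * (TV.toCertDataVW kitOf wT sc).δ j *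
          (TV.toCertDataVW kitOf wT sc).τs * (TV.toCertDataVW kitOf wT sc).ω j k - (TV.toCertDataVW kitOf wT sc).mm)
        ≤ (TV.toBoxesW kitOf wT).lo j s' i k ∧
      (TV.toBoxesW kitOf wT).hi j s' i k ≤ (TV.toCertDataVW kitOf wT sc).M k - (TV.toCertDataVW kitOf wT sc).Λ j *
          (TV.toCertDataVW kitOf wT sc).δ j * (TV.toCertDataVW kitOf wT sc).τs * (TV.toCertDataVW kitOf wT sc).ω j k -
          (TV.toCertDataVW kitOf wT sc).mm := by
  intro s' hs' i k hk1 hk2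
  have hk : -TV.base.Kb ≤ k ∧ k ≤ TV.base.Ka := ⟨hk1, hk2⟩
  have ht := (allN_eq_true.1 h4) s' hs'
  have h := TV.base.testR4_sound ht (M := fun k => (TV.toCertDataVW kitOf wT sc).M k)
    (a := fun k => (TV.toCertDataVW kitOf wT sc).Λ j * (TV.toCertDataVW kitOf wT sc).δ j * (TV.toCertDataVW kitOf wT sc).τs *
        (TV.toCertDataVW kitOf wT sc).ω j k + (TV.toCertDataVW kitOf wT sc).mm)
    (fun i k h1 h2 => mem_MB i ⟨h1, h2⟩) (fun i k h1 h2 => mem_AB j i ⟨h1, h2⟩) i hk1 hk2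
  rw [bx_lo, bx_hi, bx_loK, bx_hiK]
  obtain ⟨h1, h2, h3, h4'⟩ := h
  refine ⟨h1, h2, by linarith, by linarith⟩

/-! ### (R5), (R7), (R8) -/

/-- Coefficient enclosures of a list-coded covector. [folklore] -/
theorem mem_covB (w : List QS2) : ∀ c < TV.base.n, IntervalD.mem (QS2.toRealHom (vget w c)) (IntervalD.aget (TV.covB w) c) := by
  intro c hc
  unfold covB; rw [IntervalD.aget_ofFn _ hc]; exact IntervalD.mem_ofQS2 _ _

/-- **(R5)** of `ReadoutsV` at stage `j`. [folklore] -/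
theorem readout_R5 {j : ℕ} (hok : (TV.roOut kitOf wT A j).ok = true) :
    (∀ y, InBox (TV.toCertDataVW kitOf wT sc) ((TV.toBoxesW kitOf wT).hlo 1 j ((TV.toCertDataVW kitOf wT sc).S j - 1))
        ((TV.toBoxesW kitOf wT).hhi 1 j ((TV.toCertDataVW kitOf wT sc).S j - 1)) y →
      (TV.toCertDataVW kitOf wT sc).σf j y < (TV.toCertDataVW kitOf wT sc).lev j) ∧
    (∀ y, InBox (TV.toCertDataVW kitOf wT sc) ((TV.toBoxesW kitOf wT).hlo 1 j ((TV.toCertDataVW kitOf wT sc).S j))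
        ((TV.toBoxesW kitOf wT).hhi 1 j ((TV.toCertDataVW kitOf wT sc).S j)) y →
      (TV.toCertDataVW kitOf wT sc).lev j < (TV.toCertDataVW kitOf wT sc).σf j y) := by
  have h := TV.base.readoutStep_R5 (TV.roIn kitOf wT A j) hok (mem_covB (TV.base.stage j).σf) (IntervalD.mem_ofQS2 TV.prec (TV.base.stage j).lev)
  refine ⟨fun y hy => ?_, fun y hy => ?_⟩
  · rw [cd_sigma, cd_lev]; exact h.1 y (memVec_of_inBox_hull hy)
  · rw [cd_sigma, cd_lev]; exact h.2 y (memVec_of_inBox_hull hy)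

/-- **(R7)** of `ReadoutsV` at stage `j`. [folklore] -/
theorem readout_R7 (hk : KitOK TV kitOf) {G : ℕ → ℕ → ℕ → ℝ} {ΛT : ℕ → ℝ} {j : ℕ} (hok : (TV.roOut kitOf wT A j).ok = true) :
    ∀ y, InBox (TV.toCertDataVW kitOf wT sc) ((TV.toReadoutData kitOf wT A G ΛT).ylo 1 j) ((TV.toReadoutData kitOf wT A G ΛT).yhi 1 j) y →
      (TV.toCertDataVW kitOf wT sc).γ j ≤ (TV.toCertDataVW kitOf wT sc).σf j ((TV.toCertDataVW kitOf wT sc).Qb y y) := by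
  intro y hy
  rw [ro_ylo1, ro_yhi1] at hy
  rw [cd_gamma, cd_sigma, cd_Qb]
  exact TV.base.readoutStep_R7 (TV.roIn kitOf wT A j) hk.coef (hk.box j) (hk.mt j) hok (mem_covB (TV.base.stage j).σf)
    (IntervalD.mem_ofQS2 TV.prec (TV.base.stage j).γ) y (memVec_of_inBox_loR hy)

/-- The behind-shell surrogate is below the real constant. [folklore] -/
theorem rlo_le (hA : TV.base.checkReadoutAux A = true) :
    (TV.rlo A).toReal ≤ (2:ℝ) ^ (-(TV.toCertDataVW kitOf wT sc).θ) *
      ((TV.toCertDataVW kitOf wT sc).Cb * (2:ℝ) ^ ((3:ℝ) / 4 * (((TV.toCertDataVW kitOf wT sc).Kb : ℝ) + 1))) := by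
  have hs := TV.base.aux_sound QS2.toRealHom_monotone A hA
  obtain ⟨_, _, hCb, hp0, hp, hr0, hr, _⟩ := hs
  rw [cd_theta, cd_Cb, cd_Kb]
  have hm := (IntervalD.mem_ofQS2 TV.prec (A.pθ * TV.base.Cb * A.r34)).1
  unfold rlo
  refine le_trans hm ?_
  rw [map_mul, map_mul]
  have h2 : (0:ℝ) ≤ (2:ℝ) ^ (-(QS2.toRealHom TV.base.θ)) := (Real.rpow_pos_of_pos (by norm_num) _).le
  calc QS2.toRealHom A.pθ * QS2.toRealHom TV.base.Cb * QS2.toRealHom A.r34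
      ≤ (2:ℝ) ^ (-(QS2.toRealHom TV.base.θ)) * QS2.toRealHom TV.base.Cb * (2:ℝ) ^ ((3:ℝ) / 4 * ((TV.base.Kb:ℝ) + 1)) := by
        apply mul_le_mul (mul_le_mul_of_nonneg_right hp hCb) hr hr0
        exact mul_nonneg h2 hCb
    _ = _ := by ring

/-- The tail surrogate dominates `TailOK`. [folklore] -/
theorem tail_le (hA : TV.base.checkReadoutAux A = true) {v : Fin 4 → ℝ} (hv : TailOK (TV.toCertDataVW kitOf wT sc) v) :
    ∀ i, |v i| ≤ (TV.tvD A).toReal := by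
  have hs := TV.base.aux_sound QS2.toRealHom_monotone A hA
  have ht := hs.2.2.2.2.2.2.2
  intro i
  have h1 := hv i
  rw [cd_Cg, cd_Ka] at h1
  exact le_trans h1 (le_trans ht (IntervalD.mem_ofQS2 TV.prec A.tv).2)

/-- `Λδτs·ω(−Kb) ∈ AK`. [folklore] -/
theorem mem_AK (hA : TV.base.checkReadoutAux A = true) (j : ℕ) :
    IntervalD.mem ((TV.toCertDataVW kitOf wT sc).Λ j * (TV.toCertDataVW kitOf wT sc).δ j * (TV.toCertDataVW kitOf wT sc).τs *
        (TV.toCertDataVW kitOf wT sc).ω j (-(TV.toCertDataVW kitOf wT sc).Kb)) (TV.roIn kitOf wT A j).AK := by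
  have hs := TV.base.aux_sound QS2.toRealHom_monotone A hA
  have hKK : -TV.base.Kb ≤ -TV.base.Kb ∧ -TV.base.Kb ≤ TV.base.Ka := ⟨le_rfl, by linarith [hs.1, hs.2.1]⟩
  rw [cd_Kb, cd_Lam, cd_delta, cd_tau, cd_omega j (0 : Fin 4) hKK]
  have e0 : TV.base.wgt j (TV.base.idx 0 (-TV.base.Kb)) = vget (TV.base.stage j).ω 0 := by
    unfold CertTables.wgt; rw [idx_mod_m 0 hKK]; simp
  rw [e0]
  show IntervalD.mem _ (IntervalD.ofQS2 TV.prec ((TV.base.stage j).Λ * (TV.base.stage j).δ * TV.base.τs * vget (TV.base.stage j).ω 0))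
  have e : QS2.toRealHom (TV.base.stage j).Λ * QS2.toRealHom (TV.base.stage j).δ * QS2.toRealHom TV.base.τs *
      QS2.toRealHom (vget (TV.base.stage j).ω 0) =
      QS2.toRealHom ((TV.base.stage j).Λ * (TV.base.stage j).δ * TV.base.τs * vget (TV.base.stage j).ω 0) := by
    simp only [map_mul]
  rw [e]; exact IntervalD.mem_ofQS2 _ _

/-- **(R8)** of `ReadoutsV` at stage `j`. [folklore] -/
theorem readout_R8 (hA : TV.base.checkReadoutAux A = true) {G : ℕ → ℕ → ℕ → ℝ} {ΛT : ℕ → ℝ} {j : ℕ} (hok : (TV.roOut kitOf wT A j).ok = true) :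
    ∀ y, InBox (TV.toCertDataVW kitOf wT sc) ((TV.toReadoutData kitOf wT A G ΛT).ylo 1 j) ((TV.toReadoutData kitOf wT A G ΛT).yhi 1 j) y →
      (TV.toCertDataVW kitOf wT sc).σf j y = (TV.toCertDataVW kitOf wT sc).lev j →
      (TV.toCertDataVW kitOf wT sc).as j ≤ |y (TV.toCertDataVW kitOf wT sc).i₀ 1| ∧
      ∀ i, |y i (-(TV.toCertDataVW kitOf wT sc).Kb)| + (TV.toCertDataVW kitOf wT sc).Λ j * (TV.toCertDataVW kitOf wT sc).δ j *
          (TV.toCertDataVW kitOf wT sc).τs * (TV.toCertDataVW kitOf wT sc).ω j (-(TV.toCertDataVW kitOf wT sc).Kb) ≤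
        (2:ℝ) ^ (-(TV.toCertDataVW kitOf wT sc).θ) *
          ((TV.toCertDataVW kitOf wT sc).Cb * (2:ℝ) ^ ((3:ℝ) / 4 * (((TV.toCertDataVW kitOf wT sc).Kb : ℝ) + 1))) := by
  intro y hy _
  rw [ro_ylo1, ro_yhi1] at hy
  have h := TV.base.readoutStep_R8 (TV.roIn kitOf wT A j) hok (IntervalD.mem_ofQS2 TV.prec (TV.base.stage j).as)
    (mem_AK (kitOf := kitOf) (wT := wT) (sc := sc) hA j) (rlo_le (kitOf := kitOf) (wT := wT) (sc := sc) hA) y (memVec_of_inBox_loR hy)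
  rw [cd_as, cd_i0]
  refine ⟨h.1, fun i => ?_⟩
  have h2 := h.2 i
  rw [cd_Kb] at h2 ⊢
  exact h2

/-! ### Kernel actions in coordinates -/

/-- Window values of a kernel action. [folklore] -/
theorem wv_kapp (Ak : Ker) (v : Fin 4 → ℤ → ℝ) {c : ℕ} (hc : c < TV.base.n) :
    TV.base.wv (kapp (TV.toCertDataVW kitOf wT sc) Ak v) c =
      ∑ c' ∈ Finset.range TV.base.n, Ak (TV.base.wi c) (TV.base.wk c) (TV.base.wi c') (TV.base.wk c') * TV.base.wv v c' := by
  rw [TV.base.kapp_eq_linF cd_Kb cd_Ka Ak v, TV.base.wv_linF _ _ hc]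
  rfl

/-- Window entries of a kernel action. [folklore] -/
theorem kapp_window (Ak : Ker) (v : Fin 4 → ℤ → ℝ) (i' : Fin 4) {k' : ℤ} (hk' : -TV.base.Kb ≤ k' ∧ k' ≤ TV.base.Ka) :
    kapp (TV.toCertDataVW kitOf wT sc) Ak v i' k' =
      ∑ c ∈ Finset.range TV.base.n, Ak i' k' (TV.base.wi c) (TV.base.wk c) * TV.base.wv v c := by
  have h := wv_kapp (TV := TV) (kitOf := kitOf) (wT := wT) (sc := sc) Ak v (TV.base.idx_lt_n i' hk')
  rw [TV.base.wv_idx _ i' hk'] at h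
  rw [h]
  refine Finset.sum_congr rfl fun c _ => by rw [TV.base.wi_idx i' hk', TV.base.wk_idx i' hk']

/-- Window values of a basis state. [folklore] -/
theorem wv_basisSt (i : Fin 4) {k : ℤ} (hk : -TV.base.Kb ≤ k ∧ k ≤ TV.base.Ka) {c : ℕ} (hc : c < TV.base.n) :
    TV.base.wv (basisSt i k) c = if c = TV.base.idx i k then 1 else 0 := by
  unfold CertTables.wv basisSt
  by_cases h : c = TV.base.idx i k
  · have h1 : TV.base.wi c = i := by rw [h, TV.base.wi_idx i hk]
    have h2 : TV.base.wk c = k := by rw [h, TV.base.wk_idx i hk]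
    rw [if_pos ⟨h1, h2⟩, if_pos h]
  · have hne : ¬(TV.base.wi c = i ∧ TV.base.wk c = k) := by
      rintro ⟨h1, h2⟩
      exact h (by rw [← h1, ← h2, TV.base.idx_wi_wk hc])
    rw [if_neg hne, if_neg h]

end CertTablesV

end Summit.NavierStokesRegularity.NavierStokesRegularity.Theorems.TaylorModelCert
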